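import Literature.AlgebraicGeometry.Resolution.PrincipalizationToResolution
import HarnessLib

/-!
# The Abramovich–Oort conjecture and resolution of singularities (Temkin 2013, §1)

Topic: `Literature/AlgebraicGeometry/Resolution`. Companion to `Alterations.lean`, where the named
conjecture `AbramovichOortConjecture` (Temkin 2013, Conj. 1.3.1 = Abramovich–Oort [AO, 2.9]: every
integral algebraic variety admits an alteration `f : Y → X` with `Y` regular and `k(Y)/k(X)` purely
inseparable) is vendored as a `def … : Prop`.

## Status of the conjecture (why there is no `AbramovichOortConjecture_holds`)

The statement is an OPEN PROBLEM, not a published theorem: Temkin 2013, p. 3, right after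
Conj. 1.3.1: "This is conjecture [AO], and it is absolutely open so far. Our main result is its local
version along a valuation" (Thm. 1.3.2, inseparable local uniformization), and p. 5: "It seems very
unlikely that our method as it is can be globalized to give an a-la de Jong proof of the conjecture."
The strongest unconditional results in its direction are de Jong 1997, Cor. 5.15 (a purely
inseparable alteration whose source is the coarse moduli space of a smooth Deligne–Mumford stack,
not a regular scheme; as quoted in Abramovich–Temkin–Włodarczyk 2024, p. 8, fn. 1) and Temkin 2017
(abstract and §1.2, Thm. 1.2.5: desingularisation "by a `char(X)`-alteration, i.e. an alteration
whose order is only divisible by primes non-invertible on `X`" — the degree is a power of `p`, the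
extension `k(X')/k(X)` is not asserted purely inseparable). By `lean/CONVENTIONS.md` §4 an open
conjecture stays a `def`, never a `theorem`.

## Content (all proved): where the conjecture sits relative to resolution of singularities

Temkin 2013, §1, p. 3 organises desingularisation results by the shape of the regular covering
`f : Y → X`: "(i) Actual desingularization: `m = 1` and `K₁ = K`" is the special case of
"(iii) Alterations: `m = 1` and `f` is proper" in which the function field extension is trivial, in
particular purely inseparable. In the language of this topic: a resolution of singularities of an
integral `X` (`IsResolution`: proper, birational, regular source) is a purely inseparable alteration
with regular source (`IsPurelyInseparableAlteration`), so the conjecture is implied by resolution of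
singularities, characteristic by characteristic.

* `IsBirational.isDominant`, `IsBirational.isIntegral` — a birational `π : X' → X` is dominant, and
  if `X` is integral and `X'` reduced then `X'` is integral (`IsBirational.irreducibleSpace` of
  `QuasiProjectiveResolution.lean`; a regular scheme is reduced, `Scheme.IsRegular.isReduced` of
  `PrincipalizationToResolution.lean`, from Matsumura Thm. 14.3).
* `IsResolution.isPurelyInseparableAlteration` — Temkin 2013, §1 (i) ⊂ (iii): a resolution of an
  integral scheme is a purely inseparable alteration (finite and radicial over the open `U` over
  which it is an isomorphism).
* `Scheme.HasResolution.exists_isPurelyInseparableAlteration_and_isRegular` — hence yields the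
  conclusion of the conjecture for that `X`.
* `abramovichOort_of_resolutionInChar` — `ResolutionInChar p` gives the conjecture for varieties
  over fields of characteristic `p`; `abramovichOortConjecture_of_forall_resolutionInChar` —
  resolution in every characteristic gives `AbramovichOortConjecture`;
  `abramovichOortConjecture_of_hironaka1964_of_resolutionOfSingularities` — in universe `0`,
  `Hironaka1964` together with the summit statement `ResolutionOfSingularities` gives it.
* Known cases, from the named facts of `ResolutionOfSingularities.lean`:
  `abramovichOort_of_hironaka1964` (characteristic `0`, Temkin 2013, §1 (i): "Proved by Hironaka"),
  `abramovichOort_of_cossartPiltant2019` (dimension `≤ 3`, loc. cit.: "the case of threefolds was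
  proved recently by Cossart and Piltant"), and unconditionally
  `abramovichOort_of_topologicalKrullDim_le_zero` (dimension `0`).
* API: `IsPurelyInseparableAlteration.surjective`, `IsPurelyInseparableAlteration.exists_dense` (for
  integral `X` the open of finiteness/radiciality may be taken dense — the form used on the summit
  side).

## Sources

* M. Temkin, *Inseparable local uniformization*, J. Algebra 373 (2013) 65–119 (= arXiv:0804.1554v3;
  PDF numbering): §1 p. 3 (i), (iii), (v); Conj. 1.3.1 p. 3 and the sentence after it; p. 5.
* M. Temkin, *Tame distillation and desingularization by p-alterations*, Ann. Math. 186 (2017)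
  (= arXiv:1508.06255), abstract, §1.2.1–1.2.3, Thm. 1.2.5.
* A. J. de Jong, *Families of curves and alterations*, Ann. Inst. Fourier 47 (1997), Cor. 5.15, as
  quoted by D. Abramovich, M. Temkin, J. Włodarczyk, *Functorial embedded resolution via weighted
  blowings up*, Algebra Number Theory 18 (2024) 1557–1587, p. 8 fn. 1.
* H. Matsumura, *Commutative Ring Theory* (1987), Thm. 14.3.
* The Stacks Project, Tag 01RN (birational), Tag 02IS (regular schemes), Tag 0CC1 (dominant).
-/

noncomputable section

open CategoryTheory AlgebraicGeometry TopologicalSpace Topology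

namespace Literature.AlgebraicGeometry.Resolution

universe u

/-! ## Birational morphisms onto an integral scheme -/

/-- A birational morphism is dominant: its image contains the dense open over which it is an
isomorphism (Stacks, Tag 01RN with 0CC1). [folklore] -/
theorem IsBirational.isDominant {X' X : Scheme.{u}} {π : X' ⟶ X} (hπ : IsBirational π) :
    IsDominant π := by
  obtain ⟨U, hU, -, hiso⟩ := hπ
  haveI : IsDominant U.ι := ⟨by rw [DenseRange, Scheme.Opens.range_ι]; exact hU⟩
  haveI : IsDominant ((π ⁻¹ᵁ U).ι ≫ π) := by
    rw [← morphismRestrict_ι]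
    infer_instance
  exact IsDominant.of_comp (π ⁻¹ᵁ U).ι π

/-- The source of a birational morphism onto an irreducible (e.g. integral) scheme is integral as
soon as it is reduced: it is irreducible because the dense open `π⁻¹(U) ≅ U` is
(`IsBirational.irreducibleSpace`; Stacks, Tag 01RN, the case of schemes with finitely many
irreducible components). [folklore] -/
theorem IsBirational.isIntegral {X' X : Scheme.{u}} {π : X' ⟶ X} (hπ : IsBirational π)
    [IrreducibleSpace X] [IsReduced X'] : IsIntegral X' :=
  haveI := hπ.irreducibleSpace
  isIntegral_of_irreducibleSpace_of_isReduced X'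

/-! ## A resolution is a purely inseparable alteration (Temkin 2013, §1 (i) ⊂ (iii)) -/

/-- **A desingularisation is a purely inseparable alteration** (Temkin 2013, §1, p. 3: "(i) Actual
desingularization: `m = 1` and `K₁ = K`" as the special case of "(iii) Alterations: `m = 1` and `f`
is proper"): if `X` is integral and `π : X' → X` is proper and birational with `X'` regular, then
`X'` is integral, `π` is dominant, and over the dense open `U` where `π` is an isomorphism it is
finite and radicial. [cite: Temkin2013, §1 p. 3 (i), (iii)] -/
theorem IsResolution.isPurelyInseparableAlteration {X' X : Scheme.{u}} {π : X' ⟶ X} [IsIntegral X]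
    (h : IsResolution π) : IsPurelyInseparableAlteration π := by
  haveI : IsReduced X' := h.isRegular.isReduced
  haveI : IsIntegral X' := h.isBirational.isIntegral
  haveI : IsDominant π := h.isBirational.isDominant
  refine ⟨inferInstance, h.isProper, inferInstance, ?_⟩
  obtain ⟨U, hU, -, hiso⟩ := h.isBirational
  exact ⟨U, hU.nonempty, inferInstance, inferInstance⟩

/-- If an integral scheme admits a resolution of singularities then it admits a purely inseparable
alteration with regular source (the conclusion of the Abramovich–Oort conjecture for that scheme).
[cite: Temkin2013, §1 p. 3 (i), (iii)] -/
theorem Scheme.HasResolution.exists_isPurelyInseparableAlteration_and_isRegular {X : Scheme.{u}}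
    [IsIntegral X] (h : Scheme.HasResolution X) :
    ∃ (Y : Scheme.{u}) (φ : Y ⟶ X), IsPurelyInseparableAlteration φ ∧ Scheme.IsRegular Y := by
  obtain ⟨X', π, hπ⟩ := h
  exact ⟨X', π, hπ.isPurelyInseparableAlteration, hπ.isRegular⟩

/-! ## The conjecture from resolution of singularities, characteristic by characteristic -/

/-- Resolution of singularities in characteristic `p` (`ResolutionInChar p`) implies the
Abramovich–Oort conjecture for integral separated schemes of finite type over fields of
characteristic `p`. [cite: Temkin2013, §1 p. 3 (i), (iii) and Conj. 1.3.1] -/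
theorem abramovichOort_of_resolutionInChar {p : ℕ} (h : ResolutionInChar.{u} p) (k : Type u)
    [Field k] [CharP k p] (X : Scheme.{u}) (f : X ⟶ Spec (.of k)) [IsSeparated f]
    [LocallyOfFiniteType f] [QuasiCompact f] [IsIntegral X] :
    ∃ (Y : Scheme.{u}) (φ : Y ⟶ X), IsPurelyInseparableAlteration φ ∧ Scheme.IsRegular Y :=
  (h k X f ‹_› ‹_› ‹_› inferInstance).exists_isPurelyInseparableAlteration_and_isRegular

/-- Resolution of singularities in every characteristic implies the Abramovich–Oort conjecture
(every field has some characteristic `p`, prime or `0`). [cite: Temkin2013, §1 p. 3 (i), (iii) and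
Conj. 1.3.1] -/
theorem abramovichOortConjecture_of_forall_resolutionInChar (h : ∀ p : ℕ, ResolutionInChar.{u} p) :
    AbramovichOortConjecture.{u} := by
  intro k _ X f hs hl hq hi
  obtain ⟨p, hp⟩ := CharP.exists k
  exact abramovichOort_of_resolutionInChar (h p) k X f

/-- In universe `0`: Hironaka's theorem (`Hironaka1964`, characteristic `0`) together with the summit
statement `ResolutionOfSingularities` (every prime characteristic) implies the Abramovich–Oort
conjecture — the conjecture is weaker than resolution of singularities in positive characteristic.
[cite: Temkin2013, §1 p. 3 (i), (iii) and Conj. 1.3.1] -/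
theorem abramovichOortConjecture_of_hironaka1964_of_resolutionOfSingularities
    (h0 : Hironaka1964.{0}) (hp : ResolutionOfSingularities) : AbramovichOortConjecture.{0} := by
  refine abramovichOortConjecture_of_forall_resolutionInChar fun p => ?_
  intro k _ _ X f hs hl hq hr
  rcases CharP.char_is_prime_or_zero k p with hprime | rfl
  · exact hp p hprime k X f hs hl hq hr
  · exact h0 k X f hs hl hq hr

/-! ## Known cases -/

/-- **Characteristic zero** (Temkin 2013, §1 (i): "Proved by Hironaka in [Hir] for varieties of
characteristic zero"): under the named fact `Hironaka1964`, every integral separated scheme of finite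
type over a field of characteristic `0` has a purely inseparable (here: birational) alteration with
regular source. [cite: Temkin2013, §1 p. 3 (i)] -/
theorem abramovichOort_of_hironaka1964 (h : Hironaka1964.{u}) (k : Type u) [Field k] [CharZero k]
    (X : Scheme.{u}) (f : X ⟶ Spec (.of k)) [IsSeparated f] [LocallyOfFiniteType f]
    [QuasiCompact f] [IsIntegral X] :
    ∃ (Y : Scheme.{u}) (φ : Y ⟶ X), IsPurelyInseparableAlteration φ ∧ Scheme.IsRegular Y :=
  abramovichOort_of_resolutionInChar (p := 0) h k X f

/-- **Dimension at most three** (Temkin 2013, §1 (i): "In positive characteristic, the case of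
threefolds was proved recently by Cossart and Piltant"): under the named fact `CossartPiltant2019`,
every integral separated scheme of finite type of dimension `≤ 3` over any field has a purely
inseparable (birational) alteration with regular source. [cite: Temkin2013, §1 p. 3 (i)] -/
theorem abramovichOort_of_cossartPiltant2019 (h : CossartPiltant2019.{u}) (k : Type u) [Field k]
    (X : Scheme.{u}) (f : X ⟶ Spec (.of k)) [IsSeparated f] [LocallyOfFiniteType f]
    [QuasiCompact f] [IsIntegral X] (hdim : topologicalKrullDim X ≤ 3) :
    ∃ (Y : Scheme.{u}) (φ : Y ⟶ X), IsPurelyInseparableAlteration φ ∧ Scheme.IsRegular Y :=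
  (h k X f ‹_› ‹_› ‹_› inferInstance hdim).exists_isPurelyInseparableAlteration_and_isRegular

/-- **Dimension zero**, unconditionally: an integral scheme of dimension `0` is regular
(`Scheme.IsRegular.of_topologicalKrullDim_le_zero`), so the identity is a purely inseparable
alteration with regular source (cf. de Jong 1996, 4.3). [folklore] -/
theorem abramovichOort_of_topologicalKrullDim_le_zero (X : Scheme.{u}) [IsIntegral X]
    (hdim : topologicalKrullDim X ≤ 0) :
    ∃ (Y : Scheme.{u}) (φ : Y ⟶ X), IsPurelyInseparableAlteration φ ∧ Scheme.IsRegular Y :=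
  ⟨X, 𝟙 X, isPurelyInseparableAlteration_id X, Scheme.IsRegular.of_topologicalKrullDim_le_zero hdim⟩

/-! ## API for purely inseparable alterations -/

/-- A purely inseparable alteration is surjective (dominant and proper). [folklore] -/
theorem IsPurelyInseparableAlteration.surjective {X' X : Scheme.{u}} {φ : X' ⟶ X}
    (h : IsPurelyInseparableAlteration φ) : Surjective φ :=
  h.isAlteration.surjective

/-- Over an integral (indeed irreducible) target the non-empty open of finiteness and radiciality
of a purely inseparable alteration is dense. [folklore] -/
theorem IsPurelyInseparableAlteration.exists_dense {X' X : Scheme.{u}} {φ : X' ⟶ X} [IsIntegral X]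
    (h : IsPurelyInseparableAlteration φ) :
    ∃ U : X.Opens, Dense (U : Set X) ∧ IsFinite (φ ∣_ U) ∧ UniversallyInjective (φ ∣_ U) := by
  obtain ⟨U, hU, hf, hui⟩ := h.exists_isFinite_universallyInjective
  exact ⟨U, U.isOpen.dense hU, hf, hui⟩

end Literature.AlgebraicGeometry.Resolution

end
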